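import Summits.KontsevichZagierPeriods.Zeta5Search.Barrier.ConeGammaBreakpoints

/-!
# ζ(5) search — BARRIER: `Φ` is continuous on the closed box (dominated convergence)

HONEST FRAMING (cell `pub-zeta5`): systematic search; no irrationality claim unless kernel-certified. MODEL objects
under Brown–Zudilin's (28)+(30) accounting ([BZ22] = arXiv:2210.03391); nothing here is a statement about `ζ(5)`;
records in print UNMOVED. Item (P2) of the «provable now» list of `BARRIER-PLAN.md` §2b (theory seat cert-2 g17,
WAKE w3 of lead/lit g23): the saving rate `Φ(a) = phi30 a = ∫_{(0,∞)} N_a(u) u⁻² du` is CONTINUOUS on the closed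
box `{a | BZBox a}` (as a function of the real direction; the N1b log-cusps are cusps of a continuous function).

Proof (dominated convergence, `MeasureTheory.continuousWithinAt_of_dominated`): for `a` in the box near `a₀` the
integrand vanishes on `(0, 1/(4s₀(a₀)))` (`savingN_eq_zero_of_small`) and is bounded by `7u⁻²` beyond; and for
every `u` off the countable set `{z/h_k(a₀)}` the 28 floors `⌊h_k(a)u⌋` are locally constant in `a` within the box
(`floor_locally_constant`, and the degenerate walls `h_k(a₀) = 0` stay at floor `0` inside the box), so
`N_a(u) = N_{a₀}(u)` near `a₀` (`savingN_congr_dir`).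

* `continuousWithinAt_phi30` — `Φ` is continuous within the box at every box direction; `continuousOn_phi30`.
Not here (honest): any modulus of continuity (that is S-E), and continuity of `C₀`, `C₁`, `γ` (sSup-defined).
-/

noncomputable section

open Set MeasureTheory Filter
open scoped Topology

namespace Summit.KontsevichZagierPeriods.Zeta5Search.Barrier.ConeGamma

/-! ### Local constancy of the floors -/

/-- Off the walls a floor is locally constant: if `x ∉ ℤ` then `⌊x + y⌋ = ⌊x⌋` for `|y| < min(x − ⌊x⌋, ⌊x⌋ + 1 − x)`. -/
theorem floor_add_eq_of_small {x y : ℝ} (hy : |y| < min (x - ⌊x⌋) (⌊x⌋ + 1 - x)) : ⌊x + y⌋ = ⌊x⌋ := by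
  have h1 := (lt_min_iff.mp hy).1
  have h2 := (lt_min_iff.mp hy).2
  have h3 := neg_abs_le y
  have h4 := le_abs_self y
  rw [Int.floor_eq_iff]
  constructor <;> linarith

/-- `a ↦ h_k(a)` is continuous (a linear form). -/
theorem continuous_h28 (k : Fin 28) : Continuous fun a : Dir => h28 a k := by
  fin_cases k <;> simp [h28] <;> fun_prop

/-- `a ↦ s₀(a)` is continuous. -/
theorem continuous_sParam_zero : Continuous fun a : Dir => sParam a 0 := by
  simp [sParam]
  fun_prop

/-- **The floors are locally constant in the direction, within the box**: for `u > 0` with `h_k(a₀)u ∉ ℤ` whenever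
`h_k(a₀) ≠ 0`, eventually (for box directions `a → a₀`) `⌊h_k(a)u⌋ = ⌊h_k(a₀)u⌋`. -/
theorem floor_locally_constant {a₀ : Dir} (k : Fin 28) {u : ℝ} (hu : 0 < u)
    (hgood : h28 a₀ k ≠ 0 → ∀ z : ℤ, h28 a₀ k * u ≠ z) :
    ∀ᶠ a in 𝓝[{a | BZBox a}] a₀, ⌊h28 a k * u⌋ = ⌊h28 a₀ k * u⌋ := by
  have hcont : Tendsto (fun a : Dir => h28 a k * u) (𝓝[{a | BZBox a}] a₀) (𝓝 (h28 a₀ k * u)) :=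
    (((continuous_h28 k).mul continuous_const).tendsto a₀).mono_left nhdsWithin_le_nhds
  by_cases hk : h28 a₀ k = 0
  · -- degenerate wall: inside the box `0 ≤ h_k(a)u < 1` eventually, so the floor stays `0`
    have hlt : ∀ᶠ a in 𝓝[{a | BZBox a}] a₀, h28 a k * u < 1 := by
      have := hcont.eventually (gt_mem_nhds (show h28 a₀ k * u < 1 by rw [hk, zero_mul]; exact one_pos))
      exact this
    have hbox : ∀ᶠ a in 𝓝[{a | BZBox a}] a₀, BZBox a := eventually_mem_nhdsWithin
    filter_upwards [hlt, hbox] with a ha hb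
    rw [hk, zero_mul, Int.floor_zero, Int.floor_eq_zero_iff]
    exact ⟨mul_nonneg (h28_nonneg_of_BZBox hb k) hu.le, ha⟩
  · -- proper wall: the value `h_k(a₀)u` is not an integer, the floor is locally constant
    set x := h28 a₀ k * u with hx
    have hD : 0 < min (x - ⌊x⌋) (⌊x⌋ + 1 - x) := by
      refine lt_min ?_ ?_
      · have h1 := Int.floor_le x
        have h2 : (⌊x⌋ : ℝ) ≠ x := fun h => hgood hk ⌊x⌋ h.symm
        exact sub_pos.mpr (lt_of_le_of_ne h1 h2)
      · linarith [Int.lt_floor_add_one x]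
    have hnear : ∀ᶠ a in 𝓝[{a | BZBox a}] a₀, |h28 a k * u - x| < min (x - ⌊x⌋) (⌊x⌋ + 1 - x) := by
      have h := (tendsto_iff_norm_sub_tendsto_zero.mp hcont).eventually (gt_mem_nhds hD)
      filter_upwards [h] with a ha
      simpa [Real.norm_eq_abs] using ha
    filter_upwards [hnear] with a ha
    have := floor_add_eq_of_small (x := x) (y := h28 a k * u - x) ha
    rwa [add_sub_cancel] at this

/-- The exceptional set of `u`: the walls `h_k(a₀)u ∈ ℤ` of the non-degenerate forms — countable. -/
theorem countable_walls (a₀ : Dir) :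
    ({u : ℝ | ∃ k : Fin 28, h28 a₀ k ≠ 0 ∧ ∃ z : ℤ, h28 a₀ k * u = z}).Countable := by
  have hsub : {u : ℝ | ∃ k : Fin 28, h28 a₀ k ≠ 0 ∧ ∃ z : ℤ, h28 a₀ k * u = z} ⊆
      ⋃ k : Fin 28, ⋃ z : ℤ, {(z : ℝ) / h28 a₀ k} := by
    intro u hu
    obtain ⟨k, hk, z, hz⟩ := hu
    refine mem_iUnion.mpr ⟨k, mem_iUnion.mpr ⟨z, ?_⟩⟩
    rw [mem_singleton_iff, ← hz, mul_div_cancel_left₀ _ hk]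
  exact (countable_iUnion fun k => countable_iUnion fun z => countable_singleton _).mono hsub

/-- **Two box directions with the same 28 floors at `u` have the same saving at `u`** (through the torus form:
the pair forms of `u·s(a)` are the `u·h_k(a)` with an index depending only on the pair). -/
theorem savingN_congr_dir {a a' : Dir} (ha : BZBox a) (ha' : BZBox a') {u : ℝ}
    (h : ∀ k : Fin 28, ⌊h28 a k * u⌋ = ⌊h28 a' k * u⌋) : savingN a u = savingN a' u := by
  rw [savingN_eq_torusN_of_BZBox ha, savingN_eq_torusN_of_BZBox ha']
  refine torusN_congr_floor fun i j hij => ?_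
  have key : ∀ b : Dir, ∀ {i j : Fin 8}, i < j → pairForm (u • sParam b) i j = h28 b (idxOf i j) * u := by
    intro b i j hlt
    rw [pairForm_smul, pairForm_eq_phiForm_idxOf _ hlt, ← one_smul ℝ (sParam b), phiForm_smul_sParam, one_mul,
      mul_comm]
  rcases lt_or_gt_of_ne hij with hlt | hlt
  · rw [key a hlt, key a' hlt, h]
  · rw [pairForm_comm, key a hlt, pairForm_comm, key a' hlt, h]

/-- **`a ↦ N_a(u)` is locally constant within the box** for every `u > 0` off the walls of `a₀`. -/
theorem savingN_eventually_eq {a₀ : Dir} (ha₀ : BZBox a₀) {u : ℝ} (hu : 0 < u)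
    (hgood : ∀ k : Fin 28, h28 a₀ k ≠ 0 → ∀ z : ℤ, h28 a₀ k * u ≠ z) :
    ∀ᶠ a in 𝓝[{a | BZBox a}] a₀, savingN a u = savingN a₀ u := by
  have h := eventually_all.mpr fun k => floor_locally_constant k hu (hgood k)
  have hbox : ∀ᶠ a in 𝓝[{a | BZBox a}] a₀, BZBox a := eventually_mem_nhdsWithin
  filter_upwards [h, hbox] with a ha hb
  exact savingN_congr_dir hb ha₀ ha

/-! ### Continuity of `Φ` -/

/-- **`Φ` is continuous within the closed box at every box direction** (dominated convergence). -/
theorem continuousWithinAt_phi30 {a₀ : Dir} (ha₀ : BZBox a₀) :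
    ContinuousWithinAt phi30 {a | BZBox a} a₀ := by
  have hs0 : 0 < sParam a₀ 0 := ha₀.1
  set ε₀ : ℝ := 1 / (4 * sParam a₀ 0) with hε₀
  have hε₀pos : 0 < ε₀ := by positivity
  -- the dominating function
  set bound : ℝ → ℝ := fun u => if u < ε₀ then 0 else 7 / u ^ 2 with hbound
  -- box directions near `a₀` have `s₀(a) < 2 s₀(a₀)`
  have hnear : ∀ᶠ a in 𝓝[{a | BZBox a}] a₀, BZBox a ∧ sParam a 0 < 2 * sParam a₀ 0 := by
    refine eventually_mem_nhdsWithin.and ?_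
    have h : ∀ᶠ a in 𝓝 a₀, sParam a 0 < 2 * sParam a₀ 0 :=
      (continuous_sParam_zero.tendsto a₀).eventually (gt_mem_nhds (by linarith))
    exact mem_nhdsWithin_of_mem_nhds h
  -- the dominating function is integrable on `(0, ∞)`
  have hbound_int : IntegrableOn bound (Ioi 0) := by
    have hsplit : Ioi (0 : ℝ) = Ioo 0 ε₀ ∪ Ici ε₀ := by
      ext u
      simp only [mem_Ioi, mem_union, mem_Ioo, mem_Ici]
      constructor
      · intro hu
        rcases lt_or_ge u ε₀ with h | h
        · exact Or.inl ⟨hu, h⟩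
        · exact Or.inr h
      · rintro (⟨hu, _⟩ | h)
        · exact hu
        · exact hε₀pos.trans_le h
    rw [hsplit]
    refine IntegrableOn.union ?_ ?_
    · refine integrableOn_zero.congr_fun (fun u hu => ?_) measurableSet_Ioo
      simp only [mem_Ioo] at hu
      simp [hbound, hu.2]
    · have hg : IntegrableOn (fun u : ℝ => 7 * u ^ (-2 : ℝ)) (Ici ε₀) := by
        rw [integrableOn_Ici_iff_integrableOn_Ioi]
        exact Integrable.const_mul (integrableOn_Ioi_rpow_of_lt (by norm_num : (-2 : ℝ) < -1) hε₀pos) 7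
      refine hg.congr_fun (fun u hu => ?_) measurableSet_Ici
      simp only [mem_Ici] at hu
      have hu0 : 0 < u := hε₀pos.trans_le hu
      simp only [hbound, if_neg (not_lt.mpr hu), Real.rpow_neg hu0.le, Real.rpow_two, div_eq_mul_inv]
  unfold phi30
  refine MeasureTheory.continuousWithinAt_of_dominated (bound := bound) ?_ ?_ hbound_int ?_
  · -- measurability
    exact Eventually.of_forall fun a =>
      ((measurable_savingN a).div (measurable_id.pow_const 2)).aestronglyMeasurable
  · -- domination, for box directions with `s₀(a) < 2 s₀(a₀)`
    filter_upwards [hnear] with a ha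
    refine ae_restrict_of_forall_mem measurableSet_Ioi fun u hu => ?_
    have hu0 : 0 < u := hu
    by_cases hlt : u < ε₀
    · have hsmall : u * (2 * sParam a 0) < 1 := by
        have h1 : u * (2 * sParam a 0) < ε₀ * (4 * sParam a₀ 0) :=
          mul_lt_mul'' hlt (by linarith [ha.2]) hu0.le (by linarith [ha.1.1])
        have h2 : ε₀ * (4 * sParam a₀ 0) = 1 := by rw [hε₀]; field_simp
        linarith
      rw [savingN_eq_zero_of_small ha.1 hu0.le hsmall]
      simp [hbound, hlt]
    · simp only [hbound, if_neg hlt]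
      rw [Real.norm_eq_abs, abs_div, abs_of_pos (pow_pos hu0 2)]
      refine div_le_div_of_nonneg_right ?_ (pow_pos hu0 2).le
      rw [abs_of_nonneg (by exact_mod_cast savingN_nonneg a u)]
      exact_mod_cast savingN_le_seven_of_BZBox ha.1 u
  · -- pointwise continuity off the walls
    have hae1 : ∀ᵐ u ∂(volume.restrict (Ioi (0 : ℝ))),
        u ∉ {u : ℝ | ∃ k : Fin 28, h28 a₀ k ≠ 0 ∧ ∃ z : ℤ, h28 a₀ k * u = z} :=
      ae_restrict_of_ae (measure_eq_zero_iff_ae_notMem.mp ((countable_walls a₀).measure_zero volume))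
    have hae2 : ∀ᵐ u ∂(volume.restrict (Ioi (0 : ℝ))), u ∈ Ioi (0 : ℝ) := ae_restrict_mem measurableSet_Ioi
    filter_upwards [hae1, hae2] with u hu1 hu2
    have hgood : ∀ k : Fin 28, h28 a₀ k ≠ 0 → ∀ z : ℤ, h28 a₀ k * u ≠ z := by
      intro k hk z hz
      exact hu1 ⟨k, hk, z, hz⟩
    have hev := savingN_eventually_eq ha₀ hu2 hgood
    refine (continuousWithinAt_const (b := (savingN a₀ u : ℝ) / u ^ 2)).congr_of_eventuallyEq
      (hev.mono fun a ha => ?_) rfl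
    simp only [ha]

/-- **`Φ` is continuous on the closed box.** -/
theorem continuousOn_phi30 : ContinuousOn phi30 {a | BZBox a} := fun _ ha => continuousWithinAt_phi30 ha

end Summit.KontsevichZagierPeriods.Zeta5Search.Barrier.ConeGamma

end
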